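import Summits.ResolutionOfSingularities.ResolutionOfSingularities.Theorems.RadicialJungCleanModelsPBasisMonomialIdeal
import Literature.AlgebraicGeometry.Resolution.QuadraticTransformWeakTransform
import HarnessLib

/-!
# Route `RadicialJung`, crux `CleanModels` (stmt-15917): Giraud 1983, Lemme 2.3 (iii) — the
# exactness computation (2.6) over an arbitrary field, via `p`-bases (step (P4) of
# `K2-DESIGN.md` §5.7)

Support file (OURS) for PROGRAMME-clean-dim2 (T2 of res-L0-w81-pv-2 g5: `stub_step`, the case of a
NON-crossing Giraud-singular point; W8.1, line `via-clean-models` of the crux `DescentPerfectToAll`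
stmt-0549). J. Giraud, Bull. SMF 111 (1983), 2.6 (pp. 119–120): at a point `ξ` of `Sing(X, df)`
with `E(f) = div(x)` (not a crossing point), writing `x f′_x = xᵃA`, `f′_y = xᵃB`, `f′_{u_i} = xᵃC_i`
along differential coordinates `(x, y, u_1, …)`, "il suffit de démontrer … que l'on a
`(x f′_x, f′_{u_i})R ⊂ x^{a+1}R + M^{a+2}`", which he proves from the expansion
`f = Σ f_{ijb}^p xⁱyʲu^b` (1.4 (2)) and "(6)" by a case analysis on the initial terms. Consequence
(2.3 (iii)): when `m = 1`, the only zero of the transform `H′` on the exceptional curve is the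
crossing point.

Here, for a local domain `R` of characteristic `p` with maximal ideal `𝔪 = (x, y)`, `x` prime, a
`p`-basis `Γ ∋ x, y` of `R` over `R^p` (Kimura–Niitsuma; infinite `Γ` allowed — the `p`-basis of a
regular local ring essentially of finite type over a NON-`F`-finite field, F-96/F-96e
`Literature/RingTheory/PBasis/`) and derivations `δ_γ` dual to `Γ`:

* `pow_frobenius_mul_pow_mem` — arithmetic: `εᵖ xⁱ ∈ xᵃ𝔪 ⇒ εᵖ xⁱ ∈ x^{a+1}R + xᵃ𝔪²`
  (`p ≥ 2`, `x` prime);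
* `giraud_exactness` — **THE COMPUTATION: if `x δ_x f`, `δ_y f` and all `δ_u f` (`u ∈ Γ ∖ {x,y}`)
  lie in `xᵃ𝔪` (i.e. `D(J) = (A, B, C_u) ⊆ 𝔪`: `c(ξ) ≠ 0`), then `x δ_x f` and all `δ_u f` lie in
  `x^{a+1}R + xᵃ𝔪²` (i.e. `(A, C_u) ⊆ xR + 𝔪²`).** Proof (a streamlining of Giraud's): the
  ideals `xᵃ𝔪`, `xᵃy𝔪` are stable under the operators `γδ_γ`, so by
  `RadicialJungCleanModelsPBasisMonomialIdeal.lean` the hypotheses pass to the individual terms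
  `c_b Γ^b` of the expansion of `f`: classes with `b_y ≠ 0` lie in `xᵃy𝔪 ⊆ xᵃ𝔪²` (this is
  Giraud's "le couple `(s−1, 1)` n'apparaît pas, car on aurait `ord_M(f′_y) < a+1`"), classes
  with `b_y = 0` are `εᵖ x^{b_x} · unit ∈ xᵃ𝔪` and the arithmetic lemma applies;
* `weakTransformChart_sup_span_eq_top_of_le` — **the chart consequence (2.3 (iii))**: if
  `D₀ ⊆ xR + 𝔪²` contains an element of order `1`, then for every `B` the weak transform of
  `D′ = D₀ + (xB)` on the chart `R[y/x]` (exceptional equation `x`) has NO zero on the exceptional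
  curve: `(D′A : x) + xA = A` — so when `m = 1` in case (B) of 2.5, no point of the exceptional
  curve other than the crossing point (the origin of the other chart) is Giraud-singular.

References: J. Giraud, Bull. SMF 111 (1983), Lemme 2.3 (iii), 2.5, 2.6 [Giraud1983]; T. Kimura,
H. Niitsuma, J. Math. Soc. Japan 32 (1980) [KimuraNiitsuma1980]. Nothing here is a statement of
Hironaka's manuscript or bears on the summit directly.
-/

noncomputable section

set_option linter.dupNamespace false -- mandated namespace of this single-conjunct summit

open IsLocalRing Literature.RingTheory.PBasis Literature.AlgebraicGeometry.Resolution

namespace Summit.ResolutionOfSingularities.ResolutionOfSingularities.Theorems.RadicialJung.CleanModels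

universe u

/-! ## Arithmetic in a local domain with a prime element `x ∈ 𝔪` -/

section Arithmetic

variable {R : Type u} [CommRing R] [IsDomain R]

/-- `w x ∈ (x)·J ↔ w ∈ J` in a domain (`x ≠ 0`). [folklore] -/
theorem mul_mem_span_singleton_mul_iff {x : R} (hx0 : x ≠ 0) (J : Ideal R) (w : R) :
    w * x ∈ Ideal.span {x} * J ↔ w ∈ J := by
  constructor
  · intro h
    obtain ⟨z, hz, hzx⟩ := Ideal.mem_span_singleton_mul.mp h
    have : z = w := mul_left_cancel₀ hx0 (by rw [hzx, mul_comm])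
    rw [← this]; exact hz
  · intro h
    rw [mul_comm w x]
    exact Ideal.mul_mem_mul (Ideal.mem_span_singleton_self x) h

variable [IsLocalRing R]

/-- **`εᵖ xⁱ ∈ xᵃ𝔪 ⇒ εᵖ xⁱ ∈ x^{a+1}R + xᵃ𝔪²`** for a prime `x` of a local domain and
`p ≥ 2` (for `a ≥ 1` the hypothesis forces `x ∈ 𝔪`): either `x^{a+1} ∣ εᵖxⁱ`, or
`εᵖxⁱ = xᵃε′ᵖ` with `ε′ ∈ 𝔪` (then `ε′ᵖ ∈ 𝔪ᵖ ⊆ 𝔪²`). [folklore] -/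
theorem pow_frobenius_mul_pow_mem {p : ℕ} (hp : 2 ≤ p) {x : R} (hxp : Prime x) :
    ∀ (a i : ℕ) (ε : R), ε ^ p * x ^ i ∈ Ideal.span {x ^ a} * maximalIdeal R →
      ε ^ p * x ^ i ∈ Ideal.span {x ^ (a + 1)} ⊔ Ideal.span {x ^ a} * maximalIdeal R ^ 2 := by
  intro a
  induction a with
  | zero =>
    intro i ε h
    rw [pow_zero, Ideal.span_singleton_one, Ideal.top_mul] at h
    rw [zero_add, pow_one, pow_zero, Ideal.span_singleton_one, Ideal.top_mul]
    cases i with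
    | zero =>
      rw [pow_zero, mul_one] at h ⊢
      have hε : ε ∈ maximalIdeal R := Ideal.IsPrime.mem_of_pow_mem inferInstance p h
      exact Ideal.mem_sup_right (Ideal.pow_le_pow_right hp (Ideal.pow_mem_pow hε p))
    | succ i =>
      rw [pow_succ x i, ← mul_assoc]
      exact Ideal.mem_sup_left (Ideal.mul_mem_left _ _ (Ideal.mem_span_singleton_self x))
  | succ a ih =>
    -- the case of a multiple of `x`
    have key : ∀ (j : ℕ) (ε : R), ε ^ p * x ^ j * x ∈ Ideal.span {x ^ (a + 1)} * maximalIdeal R →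
        ε ^ p * x ^ j * x ∈
          Ideal.span {x ^ (a + 1 + 1)} ⊔ Ideal.span {x ^ (a + 1)} * maximalIdeal R ^ 2 := by
      intro j ε h
      rw [pow_succ x a, ← Ideal.span_singleton_mul_span_singleton,
        mul_comm (Ideal.span {x ^ a}) (Ideal.span {x}), mul_assoc,
        mul_mem_span_singleton_mul_iff hxp.ne_zero] at h
      have h2 := ih j ε h
      have h3 : ε ^ p * x ^ j * x ∈
          (Ideal.span {x ^ (a + 1)} ⊔ Ideal.span {x ^ a} * maximalIdeal R ^ 2) * Ideal.span {x} :=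
        Ideal.mul_mem_mul h2 (Ideal.mem_span_singleton_self x)
      rw [Ideal.sup_mul, mul_right_comm (Ideal.span {x ^ a}) (maximalIdeal R ^ 2) (Ideal.span {x}),
        Ideal.span_singleton_mul_span_singleton, Ideal.span_singleton_mul_span_singleton,
        ← pow_succ, ← pow_succ] at h3
      exact h3
    intro i ε h
    cases i with
    | zero =>
      rw [pow_zero, mul_one] at h
      have hdvd : x ∣ ε ^ p := by
        have hle : Ideal.span {x ^ (a + 1)} * maximalIdeal R ≤ Ideal.span {x} :=
          Ideal.mul_le_right.trans
            (Ideal.span_singleton_le_span_singleton.mpr (dvd_pow_self x (Nat.succ_ne_zero a)))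
        exact Ideal.mem_span_singleton.mp (hle h)
      obtain ⟨ε₁, rfl⟩ := hxp.dvd_of_dvd_pow hdvd
      have e : (x * ε₁) ^ p * x ^ 0 = ε₁ ^ p * x ^ (p - 1) * x := by
        rw [pow_zero, mul_one, mul_pow, mul_assoc, ← pow_succ, Nat.sub_add_cancel (by omega),
          mul_comm]
      rw [pow_zero, mul_one] at e
      rw [e] at h
      rw [pow_zero, mul_one, e]
      exact key (p - 1) ε₁ h
    | succ i =>
      rw [pow_succ x i, ← mul_assoc] at h ⊢
      exact key i ε h

end Arithmetic

/-! ## Giraud's computation 2.6 -/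

section Exactness

variable {p : ℕ} [Fact p.Prime] {R : Type u} [CommRing R] [CharP R p] [IsDomain R] [IsLocalRing R]
  {Γ : Set R} (δ : Γ → Derivation ℤ R R) (hδ₁ : ∀ γ : Γ, δ γ (γ : R) = 1)
  (hδ₀ : ∀ γ γ' : Γ, γ' ≠ γ → δ γ (γ' : R) = 0)
  {x y : R} (hx : x ∈ Γ) (hy : y ∈ Γ) (hm : maximalIdeal R = Ideal.span {x, y})

include hδ₁ hδ₀ hm in
/-- **Giraud 1983, 2.6 (the proof of Lemme 2.3 (iii)), over an arbitrary `p`-basis.** Let `R` be a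
local domain of characteristic `p`, `𝔪 = (x, y)` with `x` prime, `Γ ∋ x, y` a `p`-basis of `R`
over `R^p` with dual derivations `δ_γ`, `f ∈ R`, `a ∈ ℕ`. If `x δ_x f ∈ xᵃ𝔪`, `δ_y f ∈ xᵃ𝔪` and
`δ_u f ∈ xᵃ𝔪` for all `u ∈ Γ ∖ {x, y}` — Giraud: `D(J(X,f,E(f))) = (A, B, C_u) ⊆ 𝔪` at a point
of `Sing(X, df)` with `E(f) = div(x)` — then `x δ_x f ∈ x^{a+1}R + xᵃ𝔪²` and `δ_u f ∈
x^{a+1}R + xᵃ𝔪²` for all `u ∈ Γ ∖ {x, y}` — Giraud: "`(x f′_x, f′_{u_i})R ⊂ x^{a+1}R + M^{a+2}`",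
i.e. `(A, C_u) ⊆ xR + 𝔪²`. [cite: Giraud1983, 2.6 (pp. 119–120)] -/
theorem giraud_exactness (hΓ : IsPBasisOver p (frobenius R p).range Γ) (hxp : Prime x)
    (f : R) (a : ℕ)
    (h₁ : x * δ ⟨x, hx⟩ f ∈ Ideal.span {x ^ a} * maximalIdeal R)
    (h₂ : δ ⟨y, hy⟩ f ∈ Ideal.span {x ^ a} * maximalIdeal R)
    (h₃ : ∀ γ : Γ, (γ : R) ≠ x → (γ : R) ≠ y → δ γ f ∈ Ideal.span {x ^ a} * maximalIdeal R) :
    x * δ ⟨x, hx⟩ f ∈ Ideal.span {x ^ (a + 1)} ⊔ Ideal.span {x ^ a} * maximalIdeal R ^ 2 ∧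
      ∀ γ : Γ, (γ : R) ≠ x → (γ : R) ≠ y →
        δ γ f ∈ Ideal.span {x ^ (a + 1)} ⊔ Ideal.span {x ^ a} * maximalIdeal R ^ 2 := by
  classical
  have hp2 : 2 ≤ p := (Fact.out : p.Prime).two_le
  have hym : y ∈ maximalIdeal R := hm ▸ Ideal.subset_span (by simp)
  set J : Ideal R := Ideal.span {x ^ (a + 1)} ⊔ Ideal.span {x ^ a} * maximalIdeal R ^ 2 with hJ
  -- the expansion of `f` along the `p`-basis
  obtain ⟨c, hc⟩ := IsPBasisOver.exists_monomial_expansion hΓ f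
  have hf : ∑ b ∈ c.support, (c b : R) * (b.1).prod (fun γ n => ((γ : Γ) : R) ^ n) = f := hc
  -- the monomials `xᵃ` and `xᵃy`
  have hmx : (Finsupp.single (⟨x, hx⟩ : Γ) a).prod (fun γ n => ((γ : Γ) : R) ^ n) = x ^ a := by
    rw [Finsupp.prod_single_index (h := fun (γ : Γ) (n : ℕ) => ((γ : Γ) : R) ^ n) (pow_zero _)]
  have hmxy : (Finsupp.single (⟨x, hx⟩ : Γ) a + Finsupp.single (⟨y, hy⟩ : Γ) 1).prod
      (fun γ n => ((γ : Γ) : R) ^ n) = x ^ a * y := by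
    rw [Finsupp.prod_add_index' (h := fun (γ : Γ) (n : ℕ) => ((γ : Γ) : R) ^ n)
      (fun _ => pow_zero _) (fun _ _ _ => pow_add _ _ _),
      Finsupp.prod_single_index (h := fun (γ : Γ) (n : ℕ) => ((γ : Γ) : R) ^ n) (pow_zero _),
      Finsupp.prod_single_index (h := fun (γ : Γ) (n : ℕ) => ((γ : Γ) : R) ^ n) (pow_zero _),
      pow_one]
  -- `xᵃ𝔪` and `xᵃy𝔪` are stable under the `γ δ_γ`
  have hst1 : ∀ γ : Γ, ∀ v ∈ Ideal.span {x ^ a} * maximalIdeal R,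
      (γ : R) * δ γ v ∈ Ideal.span {x ^ a} * maximalIdeal R := by
    intro γ v hv
    have := mul_derivation_mem_span_monomial_mul δ hδ₁ hδ₀ hx hy hm
      (Finsupp.single (⟨x, hx⟩ : Γ) a) γ (v := v) (by rw [hmx]; exact hv)
    rwa [hmx] at this
  have hst2 : ∀ γ : Γ, ∀ v ∈ Ideal.span {x ^ a * y} * maximalIdeal R,
      (γ : R) * δ γ v ∈ Ideal.span {x ^ a * y} * maximalIdeal R := by
    intro γ v hv
    have := mul_derivation_mem_span_monomial_mul δ hδ₁ hδ₀ hx hy hm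
      (Finsupp.single (⟨x, hx⟩ : Γ) a + Finsupp.single (⟨y, hy⟩ : Γ) 1) γ (v := v)
      (by rw [hmxy]; exact hv)
    rwa [hmxy] at this
  -- the hypotheses pass to the terms of the expansion
  have hT1 : ∀ b ∈ c.support, b.1 ⟨x, hx⟩ ≠ 0 →
      (c b : R) * (b.1).prod (fun γ n => ((γ : Γ) : R) ^ n) ∈ Ideal.span {x ^ a} * maximalIdeal R :=
    term_mem_of_mul_derivation_sum_mem δ hδ₁ hδ₀ _ hst1 ⟨x, hx⟩ c.support c (by rw [hf]; exact h₁)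
  have hT3 : ∀ γ : Γ, (γ : R) ≠ x → (γ : R) ≠ y → ∀ b ∈ c.support, b.1 γ ≠ 0 →
      (c b : R) * (b.1).prod (fun γ n => ((γ : Γ) : R) ^ n) ∈
        Ideal.span {x ^ a} * maximalIdeal R := fun γ hγx hγy =>
    term_mem_of_mul_derivation_sum_mem δ hδ₁ hδ₀ _ hst1 γ c.support c
      (by rw [hf]; exact Ideal.mul_mem_left _ _ (h₃ γ hγx hγy))
  have hT2 : ∀ b ∈ c.support, b.1 ⟨y, hy⟩ ≠ 0 →
      (c b : R) * (b.1).prod (fun γ n => ((γ : Γ) : R) ^ n) ∈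
        Ideal.span {x ^ a * y} * maximalIdeal R :=
    term_mem_of_mul_derivation_sum_mem δ hδ₁ hδ₀ _ hst2 ⟨y, hy⟩ c.support c (by
      rw [hf]
      obtain ⟨m, hmm, hmy⟩ := Ideal.mem_span_singleton_mul.mp h₂
      refine Ideal.mem_span_singleton_mul.mpr ⟨m, hmm, ?_⟩
      change x ^ a * y * m = y * δ ⟨y, hy⟩ f
      rw [← hmy]; ring)
  -- each term of the expansion lying in `xᵃ𝔪` lies in `J`
  have hterm : ∀ b ∈ c.support,
      (c b : R) * (b.1).prod (fun γ n => ((γ : Γ) : R) ^ n) ∈ Ideal.span {x ^ a} * maximalIdeal R →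
      (c b : R) * (b.1).prod (fun γ n => ((γ : Γ) : R) ^ n) ∈ J := by
    intro b hb hbm
    by_cases hby : b.1 ⟨y, hy⟩ = 0
    · -- `c_b Γ^b = εᵖ x^{b_x} · unit`
      obtain ⟨U, hU, hbU⟩ := exists_monomial_eq_pow_mul_unit δ hδ₁ hδ₀ hx hy hm b.1 hby
      obtain ⟨ε, hε⟩ := RingHom.mem_range.mp (c b).2
      have e1 : (c b : R) * (b.1).prod (fun γ n => ((γ : Γ) : R) ^ n) =
          ε ^ p * x ^ (b.1 ⟨x, hx⟩) * U := by
        rw [hbU, ← hε, frobenius_def, mul_assoc]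
      rw [e1] at hbm ⊢
      have hbm' : ε ^ p * x ^ (b.1 ⟨x, hx⟩) ∈ Ideal.span {x ^ a} * maximalIdeal R := by
        have := Ideal.mul_mem_right (↑hU.unit⁻¹ : R) _ hbm
        rwa [mul_assoc, IsUnit.mul_val_inv, mul_one] at this
      exact Ideal.mul_mem_right _ _ (pow_frobenius_mul_pow_mem hp2 hxp a _ ε hbm')
    · -- `b_y ≠ 0`: the term lies in `xᵃy𝔪 ⊆ xᵃ𝔪²`
      refine Ideal.mem_sup_right ?_
      have hle : Ideal.span {x ^ a * y} * maximalIdeal R ≤ Ideal.span {x ^ a} * maximalIdeal R ^ 2 := by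
        rw [← Ideal.span_singleton_mul_span_singleton, mul_assoc, pow_two]
        exact Ideal.mul_mono_right
          (Ideal.mul_mono_left ((Ideal.span_singleton_le_iff_mem _).mpr hym))
      exact hle (hT2 b hb hby)
  -- sum up the expansions of `γ₀ δ_{γ₀} f`
  have hsumJ : ∀ γ₀ : Γ, (∀ b ∈ c.support, b.1 γ₀ ≠ 0 →
      (c b : R) * (b.1).prod (fun γ n => ((γ : Γ) : R) ^ n) ∈
        Ideal.span {x ^ a} * maximalIdeal R) → (γ₀ : R) * δ γ₀ f ∈ J := by
    intro γ₀ hγ₀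
    rw [← hf, mul_derivation_sum_monomial (δ γ₀) γ₀ (hδ₁ γ₀) (hδ₀ γ₀) c.support (fun b => b.1) c]
    refine Ideal.sum_mem _ fun b hb => ?_
    by_cases hb0 : b.1 γ₀ = 0
    · rw [hb0, Nat.cast_zero, zero_mul]; exact J.zero_mem
    · exact Ideal.mul_mem_left _ _ (hterm b hb (hγ₀ b hb hb0))
  refine ⟨hsumJ ⟨x, hx⟩ hT1, fun γ hγx hγy => ?_⟩
  have hu := isUnit_of_coe_ne δ hδ₁ hδ₀ hx hy hm γ hγx hγy
  exact (Ideal.unit_mul_mem_iff_mem J hu).mp (hsumJ γ (hT3 γ hγx hγy))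

include hδ₁ hδ₀ hm in
/-- **Ideal form of `giraud_exactness`.** With the same hypotheses, the ideal
`J₀ = (x δ_x f) + (δ_u f : u ∈ Γ ∖ {x, y})` (Giraud's `xᵃ(A, C_u)`) is contained in
`x^{a+1}R + xᵃ𝔪²`. [cite: Giraud1983, 2.6 (pp. 119–120)] -/
theorem span_logDerivation_le_of_exactness (hΓ : IsPBasisOver p (frobenius R p).range Γ)
    (hxp : Prime x) (f : R) (a : ℕ)
    (h₁ : x * δ ⟨x, hx⟩ f ∈ Ideal.span {x ^ a} * maximalIdeal R)
    (h₂ : δ ⟨y, hy⟩ f ∈ Ideal.span {x ^ a} * maximalIdeal R)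
    (h₃ : ∀ γ : Γ, (γ : R) ≠ x → (γ : R) ≠ y → δ γ f ∈ Ideal.span {x ^ a} * maximalIdeal R) :
    Ideal.span ({x * δ ⟨x, hx⟩ f} ∪ {v : R | ∃ γ : Γ, (γ : R) ≠ x ∧ (γ : R) ≠ y ∧ δ γ f = v}) ≤
      Ideal.span {x ^ (a + 1)} ⊔ Ideal.span {x ^ a} * maximalIdeal R ^ 2 := by
  obtain ⟨H1, H3⟩ := giraud_exactness δ hδ₁ hδ₀ hx hy hm hΓ hxp f a h₁ h₂ h₃
  rw [Ideal.span_le]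
  rintro v (rfl | ⟨γ, hγx, hγy, rfl⟩)
  · exact H1
  · exact H3 γ hγx hγy

end Exactness

/-! ## The chart consequence: no zero of the transform on the exceptional curve of `R[y/x]` -/

section Chart

variable {K : Type u} [Field K] {R : Subring K} [IsRegularLocalRing R] {x y : R}

/-- **Giraud 2.3 (iii) on the chart of the exceptional equation `x`.** Let `(R, 𝔪 = (x, y))` be a
two-dimensional regular local ring, `D₀ ⊆ xR + 𝔪²` an ideal containing an element `φ₀ ∉ 𝔪²`
(Giraud: `(A, C_u)` after 2.6, of order `m = 1`), `B` arbitrary and `D′ = D₀ + (xB)` (his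
`(A + yB, A, C_u)` in the coordinates of the other chart). Then the weak transform
`(D′A : x)` on `A = R[y/x]` together with `x` generates the unit ideal: `H′` has no zero on the
exceptional curve `{x = 0}` of this chart — "le seul zéro de `H′` est le point de croisement"
(which lies in the other chart). [cite: Giraud1983, 2.6 (1) and Lemme 2.3 (iii)] -/
theorem weakTransformChart_sup_span_eq_top_of_le (hdim : ringKrullDim R = 2)
    (hm : maximalIdeal R = Ideal.span {x, y}) {D₀ : Ideal R} {φ₀ : R}
    (hD₀ : D₀ ≤ Ideal.span {x} ⊔ maximalIdeal R ^ 2) (hφ₀ : φ₀ ∈ D₀)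
    (hφ₀' : φ₀ ∉ maximalIdeal R ^ 2) (B : R) :
    weakTransformChart (K := K) x y (D₀ ⊔ Ideal.span {x * B}) 1 ⊔ Ideal.span {chartIncl x y x} =
      ⊤ := by
  have hx0 : x ≠ 0 := fun h => fst_not_mem_sq hdim hm (by rw [h]; exact Ideal.zero_mem _)
  have hxm : x ∈ maximalIdeal R := hm ▸ Ideal.subset_span (by simp)
  -- `φ₀ = r x + μ`, `μ ∈ 𝔪²`, `r` a unit
  obtain ⟨xr, hxr, μ, hμ, hsum⟩ := Submodule.mem_sup.mp (hD₀ hφ₀)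
  obtain ⟨r, rfl⟩ := Ideal.mem_span_singleton'.mp hxr
  have hr : IsUnit r := by
    by_contra hr
    apply hφ₀'
    rw [← hsum, pow_two]
    exact Ideal.add_mem _ (Ideal.mul_mem_mul ((mem_maximalIdeal _).mpr hr) hxm) (pow_two (maximalIdeal R) ▸ hμ)
  -- on the chart: `μ ∈ x²A`
  have hμA : chartIncl (K := K) x y μ ∈ Ideal.span {chartIncl (K := K) x y x ^ 2} :=
    map_chartIncl_le_span_pow hm hx0 (le_refl _) (Ideal.mem_map_of_mem _ hμ)
  obtain ⟨ν, hν⟩ := Ideal.mem_span_singleton'.mp hμA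
  -- `r + ν x ∈ (D′A : x)` since `x (r + ν x) = φ₀ ∈ D′A`
  have hW : chartIncl (K := K) x y r + ν * chartIncl x y x ∈
      weakTransformChart (K := K) x y (D₀ ⊔ Ideal.span {x * B}) 1 := by
    rw [Submodule.mem_colon_singleton, smul_eq_mul, pow_one]
    have e : (chartIncl (K := K) x y r + ν * chartIncl x y x) * chartIncl x y x =
        chartIncl x y (r * x + μ) := by
      rw [map_add, map_mul, ← hν]; ring
    rw [e, hsum]
    exact Ideal.mem_map_of_mem _ (Submodule.mem_sup_left hφ₀)
  have hrW : chartIncl (K := K) x y r ∈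
      weakTransformChart (K := K) x y (D₀ ⊔ Ideal.span {x * B}) 1 ⊔ Ideal.span {chartIncl x y x} := by
    have e : chartIncl (K := K) x y r =
        (chartIncl (K := K) x y r + ν * chartIncl x y x) - ν * chartIncl x y x := by ring
    rw [e]
    exact Ideal.sub_mem _ (Ideal.mem_sup_left hW)
      (Ideal.mem_sup_right (Ideal.mul_mem_left _ _ (Ideal.mem_span_singleton_self _)))
  exact Ideal.eq_top_of_isUnit_mem _ hrW (hr.map _)

/-- Hence no prime of the chart containing `x` (no point of the exceptional curve of `R[y/x]`)
contains the weak transform `(D′A : x)`. [cite: Giraud1983, Lemme 2.3 (iii)] -/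
theorem not_weakTransformChart_le_of_le (hdim : ringKrullDim R = 2)
    (hm : maximalIdeal R = Ideal.span {x, y}) {D₀ : Ideal R} {φ₀ : R}
    (hD₀ : D₀ ≤ Ideal.span {x} ⊔ maximalIdeal R ^ 2) (hφ₀ : φ₀ ∈ D₀)
    (hφ₀' : φ₀ ∉ maximalIdeal R ^ 2) (B : R) (Q : Ideal (chartAdjoin (K := K) x y))
    (hQ : Q ≠ ⊤) (hxQ : chartIncl x y x ∈ Q) :
    ¬ weakTransformChart (K := K) x y (D₀ ⊔ Ideal.span {x * B}) 1 ≤ Q := by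
  intro hle
  apply hQ
  rw [eq_top_iff, ← weakTransformChart_sup_span_eq_top_of_le hdim hm hD₀ hφ₀ hφ₀' B]
  exact sup_le hle ((Ideal.span_singleton_le_iff_mem _).mpr hxQ)

end Chart

end Summit.ResolutionOfSingularities.ResolutionOfSingularities.Theorems.RadicialJung.CleanModels

end
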